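import Mathlib
import Literature.MathematicalPhysics.QuantumFieldTheory.Balaban1983to89.B8Eq194CriterionFree

/-!
# [B8] (1.91) vs [4] (3.163): the criterion Q′ΔN(Q′) = 0 on the cell's lattice carriers IN EVERY DIMENSION
# (cell GAPS G-B8-19 (c), part 6: d-dimensional boxes and tori on the (3.25)-lattice carriers of `B9Thm311Lattice`)

statement-level skeleton of published theorems with citation tags; proofs where landed; nothing here is a claim
about the Yang–Mills mass gap

Seat p40 gen 9, Phase 2, B8 lane; sixth file of G-B8-19 (c) (part 1 `B8Eq194Criterion`: characterization `crit_iff` —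
read its CONTEXT / ERRATUM / HONEST SCOPE first; part 2 `…Torus`: product rule `crit_pi_iff`, periodic classification
`crit_torus_iff`; part 3 `…Dirichlet`: [4] p. 394's Dirichlet case; part 4 `…Lattice`: dictionary with the
(3.25)-lattice carriers, `H4_eq_Hp_iff_crit`; part 5 `…Free`: free chains/boxes `crit_free_box_iff` and the d = 1
carriers `H4_eq_Hp_iff_free_chain`).  Kind: located reading note, constants only — NOT an error of either paper.

WHY.  Part 5 closed the loop on the cell's own carriers only for d = 1 (HONEST SCOPE there: «§3 is d = 1 only (the
d-dimensional carriers need the identification `wOf (box bonds) = piW (pathW)`, not made)»).  This file makes that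
identification, and the periodic one, for every finite index type ι of directions: on the sites ι → Fin N with the
nearest-neighbour bonds ⟨x, x + e_i⟩ the symmetrised unit bond weights of part 4 (`wOf`) ARE the Kronecker-sum weights
of part 2 (`piW`) — exactly for the box, off the diagonal for the torus (the diagonal never enters Δ) —, and the cubic
blocks of side L are the product blocks.  Hence the classifications of parts 2 and 5 apply verbatim to [4]'s H′ versus
(1.91)'s H′ on the carriers, in every dimension, for BOTH boundary conditions the carriers realise: free (all bonds
inside the box Ω₀ = {0, …, LK − 1}^ι, no diagonal term — part 4 `lapL_flat_apply`) and periodic (Ω₀ = the whole torus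
(ℤ/(LK))^ι = Bałaban's T_η with Ω₀ = T, [Balaban1985RegularSpaces] p. 77 «Ω_j ⊂ T_η»).

CONTENT (scalar model 𝔤 = ℝ, flat background U = 1, as in parts 1–5).
§1 `lap_congr_offDiag`, **`crit_congr_offDiag`** — Δ = `lap w m` and the criterion ignore the diagonal w(x, x).
§2 PRODUCT BONDS.  `liftBonds R` = the bonds of ι → S₀ generated by a one-dimensional step relation R (one R-step in
   one coordinate, all other coordinates fixed), `indW R` = its symmetrised indicator weights on S₀;
   **`wOf_liftBonds_of_ne`**: off the diagonal, `wOf (liftBonds R) 1 = piW (fun _ => indW R)`; `wOf_liftBonds` (on the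
   diagonal too when R is irreflexive).
§3 THE TWO GEOMETRIES.  `boxBonds ι N` (steps b = a + 1 in Fin N; `indW_step = pathW N`, **`wOf_boxBonds`**) and
   `torusBonds ι N` (steps b ≡ a + 1 mod N; `indW_cyc = cycW N`, **`wOf_torusBonds_of_ne`**); `boxBonds_subset_torusBonds`;
   the criterion on the carriers' weights = the criterion of parts 2/5: `crit_boxBonds_iff`, `crit_torusBonds_iff`.
§4 CUBIC BLOCKS.  `boxBlk L K hN : (ι → Fin N) → (ι → Fin K)` (coordinatewise part 5's `finBlk`), same partition as
   `piBlk (fun _ => cycBlk L)` (`boxBlk_iff`); `crit_box_carriers_iff` (⟺ L = 1 ∨ K = 1), `crit_torus_carriers_iff`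
   (⟺ L = 1 ∨ K = 1 ∨ (L, K) = (2, 2)).
§5 ON THE CARRIERS, every ι ≠ ∅: for uniform block weights κ ≠ 0, ANY contours Γ / centres y and ANY (3.25)-data with
   a onto — **`H4_eq_Hp_iff_free_box`: [4]'s H′ ((3.163)) = (1.91)'s H′ ⟺ L = 1 ∨ K = 1** (free box) and
   **`H4_eq_Hp_iff_torus`: ⟺ L = 1 ∨ K = 1 ∨ (L, K) = (2, 2)** (torus).  Non-vacuity (the data exist: the cubes with
   axis-by-axis contours of `B9BlockSystemCubes` form an `IsBlockSystem` for these bond sets) and the packaged failing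
   cases «H′ ≠ H′₍₄₎ for every data» are the sibling file `B8Eq194CriterionCarriersWitness`.

HONEST SCOPE.  As in parts 1–5: scalar fibre, flat background, block sums ≡ means (uniform κ), unit bond weights; the
Dirichlet boundary condition of [4] p. 394 is NOT realised by these carriers (part 3 treats it on the abstract weights);
no bound, no row head changes.  The torus identification is stated off the diagonal because for N = 1 the single site
carries |ι| self-loops in `piW` but one in `wOf` — immaterial to Δ (§1).

Sources: [Balaban1985RegularSpaces] (1.91) p. 91 [PDF 17], p. 77 (T_η); [Balaban1985BackgroundPropagators]
(3.18)–(3.19) p. 393, (3.21)–(3.25) p. 394, (3.162)–(3.165) p. 429 [PDF 5, 6, 41].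
-/

namespace Literature.MathematicalPhysics.QuantumFieldTheory.Balaban1983to89.B8Eq194CriterionCarriers

open Finset Literature.MathematicalPhysics.QuantumFieldTheory.Balaban1983to89.B8Eq194Criterion
  Literature.MathematicalPhysics.QuantumFieldTheory.Balaban1983to89.B8Eq194CriterionTorus
  Literature.MathematicalPhysics.QuantumFieldTheory.Balaban1983to89.B8Eq194CriterionDirichlet
  Literature.MathematicalPhysics.QuantumFieldTheory.Balaban1983to89.B8Eq194CriterionFree
  Literature.MathematicalPhysics.QuantumFieldTheory.Balaban1983to89.B8Eq194CriterionLattice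

/-! ## §1  The criterion ignores diagonal weights -/

section OffDiag

variable {S B : Type*} [Fintype S] [DecidableEq B]

/-- Δ = `lap w m` does not see the diagonal w(x, x) (it multiplies f(x) − f(x) = 0).
[cite: Balaban1985BackgroundPropagators, (3.23) p. 394] -/
theorem lap_congr_offDiag {w w' : S → S → ℝ} (h : ∀ x z, x ≠ z → w x z = w' x z) (m : S → ℝ) (f : S → ℝ) :
    lap w m f = lap w' m f := by
  funext y
  unfold lap
  congr 1
  refine Finset.sum_congr rfl fun x _ => ?_
  by_cases hxy : y = x
  · subst hxy; rw [sub_self, mul_zero, mul_zero]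
  · rw [h y x hxy]

/-- … hence neither does the criterion Q′ΔN(Q′) = 0. [cite: Balaban1985BackgroundPropagators, (3.163)–(3.165) p. 429] -/
theorem crit_congr_offDiag {w w' : S → S → ℝ} (h : ∀ x z, x ≠ z → w x z = w' x z) {m : S → ℝ} {blk : S → B} :
    Crit w m blk ↔ Crit w' m blk := by
  unfold Crit
  simp only [lap_congr_offDiag h]

end OffDiag

/-! ## §2  Product bonds generated by a one-dimensional step relation -/

section Lift

variable {ι S₀ : Type*}

/-- The symmetrised indicator weights of a step relation: [R a b] + [R b a].
[cite: Balaban1985BackgroundPropagators, (3.23) p. 394] -/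
def indW (R : S₀ → S₀ → Prop) [DecidableRel R] (a b : S₀) : ℝ :=
  (if R a b then 1 else 0) + (if R b a then 1 else 0)

/-- helper: if z differs from x at i₀, the only coordinate off which they can agree is i₀. [folklore] -/
private theorem eq_of_agree_off {x z : ι → S₀} {i₀ : ι} (h0 : z i₀ ≠ x i₀) {i : ι}
    (hag : ∀ j, j ≠ i → z j = x j) : i = i₀ := by
  by_contra hne
  exact h0 (hag i₀ (fun h => hne h.symm))

variable [Fintype ι] [DecidableEq ι] [Fintype S₀] [DecidableEq S₀]

/-- The bonds of the product lattice ι → S₀ generated by a step relation R on S₀: (x, z) is a bond iff z arises from x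
by one R-step in one coordinate i, all other coordinates fixed (for R = «+1»: the bonds ⟨x, x + e_i⟩).
[cite: Balaban1985BackgroundPropagators, (3.23) p. 394] -/
def liftBonds (R : S₀ → S₀ → Prop) [DecidableRel R] : Finset ((ι → S₀) × (ι → S₀)) :=
  univ.filter fun b => ∃ i, R (b.1 i) (b.2 i) ∧ ∀ j, j ≠ i → b.2 j = b.1 j

/-- Membership in `liftBonds`. [cite: Balaban1985BackgroundPropagators, (3.23) p. 394] -/
theorem mem_liftBonds (R : S₀ → S₀ → Prop) [DecidableRel R] (x z : ι → S₀) :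
    (x, z) ∈ liftBonds (ι := ι) R ↔ ∃ i, R (x i) (z i) ∧ ∀ j, j ≠ i → z j = x j := by
  unfold liftBonds
  simp only [mem_filter, mem_univ, true_and]

/-- `liftBonds` is monotone in the step relation. [folklore] -/
private theorem liftBonds_mono {R R' : S₀ → S₀ → Prop} [DecidableRel R] [DecidableRel R']
    (h : ∀ a b, R a b → R' a b) : liftBonds (ι := ι) R ⊆ liftBonds (ι := ι) R' := by
  rintro ⟨x, z⟩ hb
  rw [mem_liftBonds] at hb ⊢
  obtain ⟨i, hi, hj⟩ := hb
  exact ⟨i, h _ _ hi, hj⟩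

/-- **Off the diagonal, the symmetrised unit weights of the product bonds are the Kronecker-sum weights** of part 2
with the one-dimensional factor `indW R`. [cite: Balaban1985BackgroundPropagators, (3.23) p. 394] -/
theorem wOf_liftBonds_of_ne (R : S₀ → S₀ → Prop) [DecidableRel R] (x z : ι → S₀) (hxz : x ≠ z) :
    wOf (liftBonds (ι := ι) R) (fun _ => (1 : ℝ)) x z = piW (fun _ : ι => indW R) x z := by
  obtain ⟨i₀, h0⟩ : ∃ i₀, z i₀ ≠ x i₀ := Function.ne_iff.1 (Ne.symm hxz)
  have hpi : piW (fun _ : ι => indW R) x z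
      = ∑ i, if (∀ j, j ≠ i → z j = x j) then indW R (x i) (z i) else 0 := rfl
  unfold wOf
  rw [hpi]
  simp only [mem_liftBonds]
  by_cases hcase : ∀ j, j ≠ i₀ → z j = x j
  · -- x and z differ exactly in the coordinate i₀
    have hcase' : ∀ j, j ≠ i₀ → x j = z j := fun j hj => (hcase j hj).symm
    have h1 : (∃ i, R (x i) (z i) ∧ ∀ j, j ≠ i → z j = x j) ↔ R (x i₀) (z i₀) := by
      refine ⟨?_, fun h => ⟨i₀, h, hcase⟩⟩
      rintro ⟨i, hi, hag⟩
      rw [eq_of_agree_off h0 hag] at hi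
      exact hi
    have h2 : (∃ i, R (z i) (x i) ∧ ∀ j, j ≠ i → x j = z j) ↔ R (z i₀) (x i₀) := by
      refine ⟨?_, fun h => ⟨i₀, h, hcase'⟩⟩
      rintro ⟨i, hi, hag⟩
      have hag' : ∀ j, j ≠ i → z j = x j := fun j hj => (hag j hj).symm
      rw [eq_of_agree_off h0 hag'] at hi
      exact hi
    rw [Finset.sum_eq_single i₀ (fun i _ hi => if_neg fun hag => hi (eq_of_agree_off h0 hag))
      (fun h => absurd (mem_univ _) h), if_pos hcase]
    unfold indW
    simp only [h1, h2]
  · -- x and z differ in at least two coordinates: both sides vanish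
    have hnone : ∀ i, ¬ (∀ j, j ≠ i → z j = x j) := by
      intro i hag
      have := eq_of_agree_off h0 hag
      subst this
      exact hcase hag
    have h1 : ¬ (∃ i, R (x i) (z i) ∧ ∀ j, j ≠ i → z j = x j) := by
      rintro ⟨i, -, hag⟩; exact hnone i hag
    have h2 : ¬ (∃ i, R (z i) (x i) ∧ ∀ j, j ≠ i → x j = z j) := by
      rintro ⟨i, -, hag⟩; exact hnone i fun j hj => (hag j hj).symm
    rw [if_neg h1, if_neg h2, add_zero]
    exact (Finset.sum_eq_zero fun i _ => if_neg (hnone i)).symm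

/-- For an irreflexive step relation the identification holds everywhere (both sides vanish on the diagonal).
[cite: Balaban1985BackgroundPropagators, (3.23) p. 394] -/
theorem wOf_liftBonds (R : S₀ → S₀ → Prop) [DecidableRel R] (hR : ∀ a, ¬ R a a) :
    wOf (liftBonds (ι := ι) R) (fun _ => (1 : ℝ)) = piW (fun _ : ι => indW R) := by
  funext x z
  by_cases hxz : x = z
  · subst hxz
    have hpi : piW (fun _ : ι => indW R) x x
        = ∑ i, if (∀ j, j ≠ i → x j = x j) then indW R (x i) (x i) else 0 := rfl
    have hnot : (x, x) ∉ liftBonds (ι := ι) R := by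
      rw [mem_liftBonds]
      rintro ⟨i, hi, -⟩
      exact hR _ hi
    unfold wOf
    rw [if_neg hnot, add_zero, hpi]
    refine (Finset.sum_eq_zero fun i _ => ?_).symm
    rw [if_pos fun j _ => rfl]
    unfold indW
    rw [if_neg (hR _), add_zero]
  · exact wOf_liftBonds_of_ne R x z hxz

end Lift

/-! ## §3  The two geometries on ι → Fin N: free box and torus -/

section Geometry

variable (ι : Type*) [Fintype ι] [DecidableEq ι] (N : ℕ)

/-- The one-dimensional step b = a + 1 inside {0, …, N − 1}. [cite: Balaban1985BackgroundPropagators, (3.23) p. 394] -/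
abbrev stepRel (a b : Fin N) : Prop := b.val = a.val + 1

/-- The one-dimensional periodic step b ≡ a + 1 (mod N). [cite: Balaban1985RegularSpaces, p. 77 (the torus T_η)] -/
abbrev cycRel (a b : Fin N) : Prop := b.val = (a.val + 1) % N

/-- The nearest-neighbour bonds ⟨x, x + e_i⟩ of the box {0, …, N − 1}^ι (free boundary: only bonds inside the box).
[cite: Balaban1985BackgroundPropagators, (3.23) p. 394] -/
def boxBonds : Finset ((ι → Fin N) × (ι → Fin N)) := liftBonds (ι := ι) (stepRel N)

/-- The nearest-neighbour bonds ⟨x, x + e_i⟩ of the torus (ℤ/N)^ι. [cite: Balaban1985RegularSpaces, p. 77 (T_η);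
Balaban1985BackgroundPropagators, (3.23) p. 394] -/
def torusBonds : Finset ((ι → Fin N) × (ι → Fin N)) := liftBonds (ι := ι) (cycRel N)

variable {ι N}

/-- The symmetrised indicator of the step «+1» is part 3's path weight `pathW`.
[cite: Balaban1985BackgroundPropagators, (3.23) p. 394] -/
theorem indW_step : indW (stepRel N) = pathW N := by
  funext a b
  unfold indW pathW
  by_cases h1 : b.val = a.val + 1
  · rw [if_pos h1, if_neg (by omega), if_pos (Or.inl h1), add_zero]
  · by_cases h2 : a.val = b.val + 1
    · rw [if_neg h1, if_pos h2, if_pos (Or.inr h2), zero_add]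
    · rw [if_neg h1, if_neg h2, if_neg (by omega), add_zero]

/-- The symmetrised indicator of the periodic step is part 2's cycle weight `cycW`.
[cite: Balaban1985BackgroundPropagators, (3.23) p. 394] -/
theorem indW_cyc : indW (cycRel N) = cycW N := by
  funext a b
  rfl

/-- Membership in `boxBonds`. [cite: Balaban1985BackgroundPropagators, (3.23) p. 394] -/
theorem mem_boxBonds (x z : ι → Fin N) :
    (x, z) ∈ boxBonds ι N ↔ ∃ i, (z i).val = (x i).val + 1 ∧ ∀ j, j ≠ i → z j = x j :=
  mem_liftBonds _ x z

/-- Membership in `torusBonds`. [cite: Balaban1985BackgroundPropagators, (3.23) p. 394] -/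
theorem mem_torusBonds (x z : ι → Fin N) :
    (x, z) ∈ torusBonds ι N ↔ ∃ i, (z i).val = ((x i).val + 1) % N ∧ ∀ j, j ≠ i → z j = x j :=
  mem_liftBonds _ x z

/-- Every box bond is a torus bond (the box {0, …, N − 1}^ι sits inside the torus T_η = (ℤ/N)^ι).
[cite: Balaban1985RegularSpaces, p. 77 (T_η); Balaban1985BackgroundPropagators, (3.23) p. 394] -/
theorem boxBonds_subset_torusBonds : boxBonds ι N ⊆ torusBonds ι N :=
  liftBonds_mono fun (a b : Fin N) (h : stepRel N a b) => by
    have hb := b.isLt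
    have h' : b.val = a.val + 1 := h
    show b.val = (a.val + 1) % N
    rw [Nat.mod_eq_of_lt (by omega)]
    exact h'

/-- **The unit bond weights of the free box are the Kronecker sum of path weights** (the identification left open in
part 5). [cite: Balaban1985BackgroundPropagators, (3.23) p. 394] -/
theorem wOf_boxBonds : wOf (boxBonds ι N) (fun _ => (1 : ℝ)) = piW (fun _ : ι => pathW N) := by
  rw [← indW_step]
  exact wOf_liftBonds (stepRel N) fun a (h : a.val = a.val + 1) => by omega

/-- **The unit bond weights of the torus are the Kronecker sum of cycle weights, off the diagonal.**
[cite: Balaban1985RegularSpaces, p. 77 (T_η); Balaban1985BackgroundPropagators, (3.23) p. 394] -/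
theorem wOf_torusBonds_of_ne (x z : ι → Fin N) (hxz : x ≠ z) :
    wOf (torusBonds ι N) (fun _ => (1 : ℝ)) x z = piW (fun _ : ι => cycW N) x z := by
  rw [← indW_cyc]
  exact wOf_liftBonds_of_ne (cycRel N) x z hxz

/-- The criterion for the box carriers' weights is the criterion of part 5's free box.
[cite: Balaban1985BackgroundPropagators, (3.163)–(3.165) p. 429] -/
theorem crit_boxBonds_iff {B : Type*} [DecidableEq B] (m : (ι → Fin N) → ℝ) (blk : (ι → Fin N) → B) :
    Crit (wOf (boxBonds ι N) (fun _ => (1 : ℝ))) m blk ↔ Crit (piW fun _ : ι => pathW N) m blk := by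
  rw [wOf_boxBonds]

/-- The criterion for the torus carriers' weights is the criterion of part 2's torus.
[cite: Balaban1985BackgroundPropagators, (3.163)–(3.165) p. 429] -/
theorem crit_torusBonds_iff {B : Type*} [DecidableEq B] (m : (ι → Fin N) → ℝ) (blk : (ι → Fin N) → B) :
    Crit (wOf (torusBonds ι N) (fun _ => (1 : ℝ))) m blk ↔ Crit (piW fun _ : ι => cycW N) m blk :=
  crit_congr_offDiag fun x z hxz => wOf_torusBonds_of_ne x z hxz

end Geometry

/-! ## §4  Cubic blocks of side L -/

section Blocks

variable {ι : Type*} {N : ℕ}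

/-- The cubic blocks of side L of {0, …, LK − 1}^ι as a block map into the unit lattice (ι → Fin K): coordinatewise
part 5's `finBlk`. [cite: Balaban1985BackgroundPropagators, (3.18)–(3.19) p. 393] -/
def boxBlk (L K : ℕ) (hN : N = L * K) (x : ι → Fin N) : ι → Fin K := fun i => finBlk L K hN (x i)

/-- Pointwise value of `boxBlk`. [cite: Balaban1985BackgroundPropagators, (3.18)–(3.19) p. 393] -/
theorem boxBlk_apply_val (L K : ℕ) (hN : N = L * K) (x : ι → Fin N) (i : ι) :
    (boxBlk L K hN x i).val = (x i).val / L := rfl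

/-- `boxBlk` and part 2's product block map `piBlk (fun _ => cycBlk L)` define the same partition.
[cite: Balaban1985BackgroundPropagators, (3.18)–(3.19) p. 393] -/
theorem boxBlk_iff (L K : ℕ) (hN : N = L * K) (x z : ι → Fin N) :
    boxBlk L K hN x = boxBlk L K hN z ↔
      piBlk (fun _ : ι => cycBlk (N := N) L) x = piBlk (fun _ : ι => cycBlk (N := N) L) z := by
  rw [funext_iff, funext_iff]
  refine forall_congr' fun i => ?_
  rw [Fin.ext_iff]
  rfl

variable [Fintype ι] [DecidableEq ι]

/-- **Classification on the free box carriers' weights**: Q′ΔN(Q′) = 0 ⟺ L = 1 ∨ K = 1 (part 5 transported).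
[cite: Balaban1985RegularSpaces, (1.91) p. 91; Balaban1985BackgroundPropagators, (3.23) p. 394, (3.163)–(3.165) p. 429] -/
theorem crit_box_carriers_iff [Nonempty ι] {L K : ℕ} (hN : N = L * K) (hL : 1 ≤ L) (hK : 1 ≤ K) :
    Crit (wOf (boxBonds ι N) (fun _ => (1 : ℝ))) 0 (boxBlk L K hN) ↔ (L = 1 ∨ K = 1) := by
  rw [crit_boxBonds_iff, crit_congr (boxBlk_iff L K hN)]
  exact crit_free_box_iff hN hL hK

/-- **Classification on the torus carriers' weights**: Q′ΔN(Q′) = 0 ⟺ L = 1 ∨ K = 1 ∨ (L, K) = (2, 2) (part 2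
transported). [cite: Balaban1985RegularSpaces, (1.91) p. 91, p. 77; Balaban1985BackgroundPropagators, (3.23) p. 394,
(3.163)–(3.165) p. 429] -/
theorem crit_torus_carriers_iff [Nonempty ι] {L K : ℕ} (hN : N = L * K) (hL : 1 ≤ L) (hK : 1 ≤ K) :
    Crit (wOf (torusBonds ι N) (fun _ => (1 : ℝ))) 0 (boxBlk L K hN) ↔ (L = 1 ∨ K = 1 ∨ (L = 2 ∧ K = 2)) := by
  rw [crit_torusBonds_iff, crit_congr (boxBlk_iff L K hN)]
  exact crit_torus_iff hN hL hK

end Blocks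

/-! ## §5  On the cell's carriers, every dimension -/

section Carriers

open B9Eq325Proj B9Thm311Lattice B8Eq191Hprime B8Eq194FirstTerm
open scoped InnerProductSpace

variable {ι : Type*} [Fintype ι] [DecidableEq ι] {N : ℕ}

/-- Q′ of (3.19) on the carriers for the cubic blocks of side L, flat scalar transports, uniform block weights κ.
[cite: Balaban1985BackgroundPropagators, (3.19) p. 393] -/
noncomputable abbrev qBox (L K : ℕ) (hN : N = L * K) (κ : ℝ) (Γ : (ι → Fin K) → (ι → Fin N) → List (ι → Fin N))
    (y : (ι → Fin K) → ι → Fin N) :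
    PiLp 2 (fun _ : ι → Fin N => ℝ) →ₗ[ℝ] PiLp 2 (fun _ : ι → Fin K => ℝ) :=
  qL (flatT (ι → Fin N)) (fun _ _ => κ) (blocksOf (boxBlk L K hN)) Γ y

/-- **On the free box carriers, every dimension.**  Sites {0, …, LK − 1}^ι with all nearest-neighbour bonds inside the
box and unit bond weights, flat background, scalar fibre, cubic blocks of side L with uniform weights κ ≠ 0, ANY
contours Γ / centres y, ANY (3.25)-data with a onto: [4]'s H′ ((3.163)) = (1.91)'s H′ ⟺ L = 1 ∨ K = 1.
[cite: Balaban1985RegularSpaces, (1.91) p. 91; Balaban1985BackgroundPropagators, (3.19) p. 393, (3.23)–(3.25)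
p. 394, (3.163)–(3.165) p. 429] -/
theorem H4_eq_Hp_iff_free_box [Nonempty ι] {L K : ℕ} (hN : N = L * K) (hL : 1 ≤ L) (hK : 1 ≤ K) {κ : ℝ}
    (hκ : κ ≠ 0) (Γ : (ι → Fin K) → (ι → Fin N) → List (ι → Fin N)) (y : (ι → Fin K) → ι → Fin N)
    {A : PiLp 2 (fun _ : ι → Fin K => ℝ) →ₗ[ℝ] PiLp 2 (fun _ : ι → Fin K => ℝ)}
    {g : PiLp 2 (fun _ : ι → Fin N => ℝ) →ₗ[ℝ] PiLp 2 (fun _ : ι → Fin N => ℝ)}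
    {c : PiLp 2 (fun _ : ι → Fin K => ℝ) →ₗ[ℝ] PiLp 2 (fun _ : ι → Fin K => ℝ)}
    (hdata : Data (lapL (flatT (ι → Fin N)) (boxBonds ι N) (fun _ => 1)) (qBox L K hN κ Γ y)
      (LinearMap.adjoint (qBox L K hN κ Γ y)) A g c)
    (hA : Function.Surjective A) :
    (∀ μ, H4 (qBox L K hN κ Γ y) (LinearMap.adjoint (qBox L K hN κ Γ y)) A g c μ
        = Hp (LinearMap.adjoint (qBox L K hN κ Γ y)) g c μ)
      ↔ (L = 1 ∨ K = 1) := by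
  rw [H4_eq_Hp_iff_crit (boxBlk L K hN) hκ Γ y (boxBonds ι N) (fun _ => 1) (fun _ _ => zero_le_one) hdata hA]
  exact crit_box_carriers_iff hN hL hK

/-- **On the torus carriers, every dimension.**  Sites (ℤ/(LK))^ι with all nearest-neighbour bonds and unit bond
weights (Ω₀ = T, Bałaban's torus), flat background, scalar fibre, cubic blocks of side L with uniform weights κ ≠ 0,
ANY contours Γ / centres y, ANY (3.25)-data with a onto:
[4]'s H′ ((3.163)) = (1.91)'s H′ ⟺ L = 1 ∨ K = 1 ∨ (L, K) = (2, 2).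
[cite: Balaban1985RegularSpaces, (1.91) p. 91, p. 77 (T_η); Balaban1985BackgroundPropagators, (3.19) p. 393,
(3.23)–(3.25) p. 394, (3.163)–(3.165) p. 429] -/
theorem H4_eq_Hp_iff_torus [Nonempty ι] {L K : ℕ} (hN : N = L * K) (hL : 1 ≤ L) (hK : 1 ≤ K) {κ : ℝ}
    (hκ : κ ≠ 0) (Γ : (ι → Fin K) → (ι → Fin N) → List (ι → Fin N)) (y : (ι → Fin K) → ι → Fin N)
    {A : PiLp 2 (fun _ : ι → Fin K => ℝ) →ₗ[ℝ] PiLp 2 (fun _ : ι → Fin K => ℝ)}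
    {g : PiLp 2 (fun _ : ι → Fin N => ℝ) →ₗ[ℝ] PiLp 2 (fun _ : ι → Fin N => ℝ)}
    {c : PiLp 2 (fun _ : ι → Fin K => ℝ) →ₗ[ℝ] PiLp 2 (fun _ : ι → Fin K => ℝ)}
    (hdata : Data (lapL (flatT (ι → Fin N)) (torusBonds ι N) (fun _ => 1)) (qBox L K hN κ Γ y)
      (LinearMap.adjoint (qBox L K hN κ Γ y)) A g c)
    (hA : Function.Surjective A) :
    (∀ μ, H4 (qBox L K hN κ Γ y) (LinearMap.adjoint (qBox L K hN κ Γ y)) A g c μ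
        = Hp (LinearMap.adjoint (qBox L K hN κ Γ y)) g c μ)
      ↔ (L = 1 ∨ K = 1 ∨ (L = 2 ∧ K = 2)) := by
  rw [H4_eq_Hp_iff_crit (boxBlk L K hN) hκ Γ y (torusBonds ι N) (fun _ => 1) (fun _ _ => zero_le_one) hdata hA]
  exact crit_torus_carriers_iff hN hL hK

end Carriers

end Literature.MathematicalPhysics.QuantumFieldTheory.Balaban1983to89.B8Eq194CriterionCarriers
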